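import Summits.CriticalPhenomena.PercolationContinuityZ3.Theorems.FK.MagnetizationExponentialLLN
import Literature.Probability.LatticeModels.GibbsEnergyBounds
import HarnessLib

/-!
# PHASE COEXISTENCE AT VOLUME ORDER: UNDER EVERY BOUNDARY CONDITION BOTH MAGNETISED PHASES `±m*(β)` ARE REACHED AT
# SURFACE-ORDER COST `e^{−4|β||∂ᵉΛ_N|}` (boundary-condition change; Ellis 2006 Thm. V.6.1 (d)–(e), Friedli–Velenik Thm. 3.6)

Claimed R42 (8)(c) in the cell INBOX at 2026-08-29T07:20:29Z by fkp-10a gen 359 (NEW CLAIM #1 of the gen), addressed to the lane under (ι) (coordinator fk-4 gen 293 CLOSED l.8789 06:52:14Z 2026-08-29; «(ι) RESUMES») and to the next seated fk-4 generation (ruling R172 requested); lineage row FO-10a-g359 (self-suggested), package g359-largedev, label LD-E.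
Helper file of the `fk-continuity` build cell (bschramm lane; `--supports stmt-CriticalPhenomena-4575`); builds on
p205010 (kernel theorem, internal audit signed; external expert review pending). No definitions, no named facts, no
sorries; standard axioms. UNCONDITIONAL (nearest-neighbour Ising model; finite volume on ANY locally finite graph for
the boundary-condition comparison; `ℤ^d` boxes `Λ_N = {−N,…,N}^d`, zero field, EVERY boundary condition for the rest;
`μ_N = μ^{bc}_{Λ_N;β,0}`, `M_N = Σ_{x∈Λ_N} σ_x`, `∂ᵉΛ` = `edgeBoundary`).

Ellis (2006), Thm. V.6.1 (d): for `β > β_c`, `h = 0`, "exponential convergence fails"; Thm. IV.5.5: `S_Λ/|Λ| →exp m`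
with respect to the finite-volume Gibbs states iff `∂ψ/∂h` exists. The files `MagnetizationLargeDeviations` /
`MagnetizationExponentialLLN` prove the sufficiency; this file supplies the finite-volume estimates behind the NECESSITY
at `h = 0` (completed in the sequel `MagnetizationExponentialConvergenceCriterion`), valid for EVERY boundary condition,
by a boundary-condition change costing `e^{4|β||∂ᵉΛ|}`:

* `sum_spinAt_glue_eq`, `abs_neg_mul_isingHamiltonian_glue_sub_free_le`, `isingWeight_le_exp_mul_isingWeight`,
  `isingPartitionFunction_le_exp_mul` — Boltzmann weights and partition functions of two boundary conditions differ
  by at most `e^{2|β||∂ᵉΛ|}` (Friedli–Velenik, proof of Thm. 3.6);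
* `measureReal_sum_spinAt_mem_eq_sum` and **`measureReal_sum_spinAt_mem_le_exp_mul`** — THE BOUNDARY-CONDITION
  CHANGE FOR EVENTS OF THE TOTAL SPIN: `μ^{bc}_{Λ;β,h}{M_Λ ∈ S} ≤ e^{4|β||∂ᵉΛ|} μ^{bc'}_{Λ;β,h}{M_Λ ∈ S}` for any two
  boundary conditions and every measurable `S ⊆ ℝ`;
* `integral_sum_spinAt_eq_sum_isingCorr`, `card_mul_spontaneousMagnetization_le_integral_sum_spinAt_plus` — under
  the `+` boundary condition `⟨M_N⟩ ≥ |Λ_N| m*(β)`; by Markov's inequality (`div_le_measureReal_ge_of_integral_ge`)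
  **`div_le_measureReal_plus_ge`** —
  `μ^{+}_{Λ_N;β,0}{M_N ≥ (m* − ε)|Λ_N|} ≥ ε/(1 − m* + ε)` for every `N`, and the mirror image
  `div_le_measureReal_minus_le` under the `−` boundary condition;
* **`exp_mul_div_le_measureReal_ge`** / `exp_mul_div_le_measureReal_le` — PHASE COEXISTENCE UNDER EVERY BOUNDARY
  CONDITION AT SURFACE-ORDER COST: `μ^{bc}_{Λ_N;β,0}{M_N ≥ (m*(β) − ε)|Λ_N|} ≥ e^{−4|β||∂ᵉΛ_N|} ε/(1 − m* + ε)` and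
  `μ^{bc}_{Λ_N;β,0}{M_N ≤ (−m*(β) + ε)|Λ_N|} ≥ e^{−4|β||∂ᵉΛ_N|} ε/(1 − m* + ε)`, every `N`, every `bc`
  (`|∂ᵉΛ_N|/|Λ_N| → 0`: this is sub-exponential in the volume);
* `eventually_exp_neg_mul_card_lt` — a surface-order lower bound defeats every volume-order exponential upper bound
  (`|∂ᵉΛ_N|/|Λ_N| → 0`); the sequel `MagnetizationExponentialConvergenceCriterion` turns this into Ellis' Thm. IV.5.5
  at `h = 0` (exponential convergence of `M_N/|Λ_N|` iff `m*(β) = 0`).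

## References

* R. S. Ellis, *Entropy, Large Deviations, and Statistical Mechanics*, Springer (1985/2006), (2.31), Thm. II.6.3,
  §IV.5 Thm. IV.5.5, §V.6 Thm. V.6.1 (d)–(e), Notes 11–13 to Ch. IV. [Ellis2006]
* S. Friedli, Y. Velenik, *Statistical Mechanics of Lattice Systems*, CUP (2017), Thm. 3.6 (proof: boundary terms),
  §3.2.1 Exercise 3.1 (van Hove boxes), Prop. 3.29, Thm. 3.34. [FriedliVelenik2017]
* O. E. Lanford, *Entropy and equilibrium states in classical statistical mechanics*, LNP 20, Springer (1973),
  1–113. [Lanford1973]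
-/

noncomputable section

namespace Summit.CriticalPhenomena.PercolationContinuityZ3.Theorems.FK

namespace IsingLargeDeviations

open MeasureTheory ProbabilityTheory Filter Topology Finset Set
open Literature.Probability.LatticeModels

/-! ### Finite volume: changing the boundary condition costs at most `e^{|β| |∂ᵉΛ|}` per weight -/

section FiniteVolume

variable {V : Type*} (G : SimpleGraph V) [DecidableEq V] [G.LocallyFinite]

omit [DecidableEq V] [G.LocallyFinite] in
/-- The total spin of a glued configuration does not depend on the boundary condition. [folklore] -/
theorem sum_spinAt_glue_eq (Λ : Finset V) (τ : Λ → ℤˣ) (bc bc' : BoundaryCondition V) :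
    ∑ x ∈ Λ, spinAt x (glue Λ τ bc) = ∑ x ∈ Λ, spinAt x (glue Λ τ bc') :=
  sum_congr rfl fun x hx => by simp only [spinAt, glue_apply_eq_glue_apply_of_mem Λ τ bc bc' hx]

/-- `|(−βH^{bc}(τ·bc)) − (−βH^∅(τ·∅))| ≤ |β| |∂ᵉΛ|`: the two energies differ by the boundary bonds only.
[cite: FriedliVelenik2017, Thm. 3.6 (proof)] -/
theorem abs_neg_mul_isingHamiltonian_glue_sub_free_le (Λ : Finset V) (β h : ℝ) (bc : BoundaryCondition V)
    (τ : Λ → ℤˣ) :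
    |-β * isingHamiltonian G Λ h bc (glue Λ τ bc) - -β * isingHamiltonian G Λ h .free (glue Λ τ .free)| ≤
      |β| * #(edgeBoundary G Λ) := by
  rw [isingHamiltonian_glue_eq_free_sub G Λ h bc τ]
  have hS : |∑ e ∈ interactionEdges G Λ bc \ edgesIn G Λ, bondSpin (glue Λ τ bc) e| ≤ #(edgeBoundary G Λ) :=
    (abs_sum_bondSpin_le _ _).trans (by
      exact_mod_cast Finset.card_le_card (interactionEdges_sdiff_edgesIn_subset_edgeBoundary G Λ bc))
  calc |-β * (isingHamiltonian G Λ h .free (glue Λ τ .free) -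
          ∑ e ∈ interactionEdges G Λ bc \ edgesIn G Λ, bondSpin (glue Λ τ bc) e) -
        -β * isingHamiltonian G Λ h .free (glue Λ τ .free)|
      = |β| * |∑ e ∈ interactionEdges G Λ bc \ edgesIn G Λ, bondSpin (glue Λ τ bc) e| := by
        rw [← abs_mul]; congr 1; ring
    _ ≤ |β| * #(edgeBoundary G Λ) := mul_le_mul_of_nonneg_left hS (abs_nonneg β)

/-- **`w^{bc}(τ) ≤ e^{2|β||∂ᵉΛ|} w^{bc'}(τ)`** for any two boundary conditions (both are within `e^{±|β||∂ᵉΛ|}` of the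
free weight). [cite: FriedliVelenik2017, Thm. 3.6 (proof)] -/
theorem isingWeight_le_exp_mul_isingWeight (Λ : Finset V) (β h : ℝ) (bc bc' : BoundaryCondition V) (τ : Λ → ℤˣ) :
    isingWeight G Λ β h bc τ ≤ Real.exp (2 * (|β| * #(edgeBoundary G Λ))) * isingWeight G Λ β h bc' τ := by
  rw [isingWeight, isingWeight, ← Real.exp_add, Real.exp_le_exp]
  have h1 := abs_neg_mul_isingHamiltonian_glue_sub_free_le G Λ β h bc τ
  have h2 := abs_neg_mul_isingHamiltonian_glue_sub_free_le G Λ β h bc' τ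
  rw [abs_le] at h1 h2
  linarith [h1.2, h2.1]

/-- **`Z^{bc} ≤ e^{2|β||∂ᵉΛ|} Z^{bc'}`** for any two boundary conditions. [cite: FriedliVelenik2017, Thm. 3.6 (proof)] -/
theorem isingPartitionFunction_le_exp_mul (Λ : Finset V) (β h : ℝ) (bc bc' : BoundaryCondition V) :
    isingPartitionFunction G Λ β h bc ≤
      Real.exp (2 * (|β| * #(edgeBoundary G Λ))) * isingPartitionFunction G Λ β h bc' := by
  rw [isingPartitionFunction, isingPartitionFunction, mul_sum]
  exact sum_le_sum fun τ _ => isingWeight_le_exp_mul_isingWeight G Λ β h bc bc' τ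

/-! ### Events of the total spin: the boundary condition changes their probability by at most `e^{4|β||∂ᵉΛ|}` -/

/-- The probability of `{M_Λ ∈ S}` as a Boltzmann-weighted sum (the indicator of a glued configuration does not see
the boundary condition). [cite: FriedliVelenik2017, §3.1 eq. (3.8)] -/
theorem measureReal_sum_spinAt_mem_eq_sum (Λ : Finset V) (β h : ℝ) (bc : BoundaryCondition V) {S : Set ℝ}
    (hS : MeasurableSet S) :
    (isingMeasure G Λ β h bc).real {σ | ∑ x ∈ Λ, spinAt x σ ∈ S} =
      (∑ τ : Λ → ℤˣ, isingWeight G Λ β h bc τ *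
          ({σ : SpinConfig V | ∑ x ∈ Λ, spinAt x σ ∈ S}.indicator 1 (glue Λ τ .free))) /
        isingPartitionFunction G Λ β h bc := by
  have hA : MeasurableSet {σ : SpinConfig V | ∑ x ∈ Λ, spinAt x σ ∈ S} := measurable_sum_spinAt Λ hS
  rw [← integral_indicator_one hA, integral_isingMeasure G Λ β h bc
    (f := ({σ : SpinConfig V | ∑ x ∈ Λ, spinAt x σ ∈ S}.indicator 1)) (measurable_const.indicator hA)]
  congr 1
  refine sum_congr rfl fun τ _ => ?_
  by_cases hτ : glue Λ τ BoundaryCondition.free ∈ {σ : SpinConfig V | ∑ x ∈ Λ, spinAt x σ ∈ S}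
  · have hτ' : glue Λ τ bc ∈ {σ : SpinConfig V | ∑ x ∈ Λ, spinAt x σ ∈ S} := by
      simp only [mem_setOf_eq] at hτ ⊢; rwa [sum_spinAt_glue_eq Λ τ bc .free]
    rw [Set.indicator_of_mem hτ', Set.indicator_of_mem hτ]
    simp only [Pi.one_apply]
  · have hτ' : glue Λ τ bc ∉ {σ : SpinConfig V | ∑ x ∈ Λ, spinAt x σ ∈ S} := by
      simp only [mem_setOf_eq] at hτ ⊢; rwa [sum_spinAt_glue_eq Λ τ bc .free]
    rw [Set.indicator_of_notMem hτ', Set.indicator_of_notMem hτ]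

/-- **THE BOUNDARY-CONDITION CHANGE: `μ^{bc}_{Λ;β,h}{M_Λ ∈ S} ≤ e^{4|β||∂ᵉΛ|} μ^{bc'}_{Λ;β,h}{M_Λ ∈ S}`** for any two
boundary conditions, every measurable `S ⊆ ℝ`, every real `β, h` (any locally finite graph): numerators differ by at
most `e^{2|β||∂ᵉΛ|}`, partition functions by at most `e^{2|β||∂ᵉΛ|}`.
[cite: FriedliVelenik2017, Thm. 3.6 (proof); Ellis2006, Note 11 to Ch. IV] -/
theorem measureReal_sum_spinAt_mem_le_exp_mul (Λ : Finset V) (β h : ℝ) (bc bc' : BoundaryCondition V)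
    {S : Set ℝ} (hS : MeasurableSet S) :
    (isingMeasure G Λ β h bc).real {σ | ∑ x ∈ Λ, spinAt x σ ∈ S} ≤
      Real.exp (4 * (|β| * #(edgeBoundary G Λ))) *
        (isingMeasure G Λ β h bc').real {σ | ∑ x ∈ Λ, spinAt x σ ∈ S} := by
  set B : ℝ := |β| * #(edgeBoundary G Λ) with hB
  set A : Set (SpinConfig V) := {σ | ∑ x ∈ Λ, spinAt x σ ∈ S} with hAdef
  rw [measureReal_sum_spinAt_mem_eq_sum G Λ β h bc hS, measureReal_sum_spinAt_mem_eq_sum G Λ β h bc' hS]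
  have hZ := isingPartitionFunction_pos G Λ β h bc
  have hZ' := isingPartitionFunction_pos G Λ β h bc'
  have hind : ∀ τ : Λ → ℤˣ, 0 ≤ A.indicator (1 : SpinConfig V → ℝ) (glue Λ τ .free) := fun τ =>
    Set.indicator_nonneg (fun _ _ => zero_le_one) _
  -- numerators: `Σ w^{bc} 1_A ≤ e^{2B} Σ w^{bc'} 1_A`; denominators: `e^{−2B} Z^{bc'} ≤ Z^{bc}`
  have hnum : ∑ τ : Λ → ℤˣ, isingWeight G Λ β h bc τ * A.indicator 1 (glue Λ τ .free) ≤
      Real.exp (2 * B) * ∑ τ : Λ → ℤˣ, isingWeight G Λ β h bc' τ * A.indicator 1 (glue Λ τ .free) := by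
    rw [mul_sum]
    refine sum_le_sum fun τ _ => ?_
    rw [← mul_assoc]
    exact mul_le_mul_of_nonneg_right (isingWeight_le_exp_mul_isingWeight G Λ β h bc bc' τ) (hind τ)
  have hden : Real.exp (-(2 * B)) * isingPartitionFunction G Λ β h bc' ≤ isingPartitionFunction G Λ β h bc := by
    have h1 := isingPartitionFunction_le_exp_mul G Λ β h bc' bc
    have h2 : Real.exp (-(2 * B)) * (Real.exp (2 * B) * isingPartitionFunction G Λ β h bc) =
        isingPartitionFunction G Λ β h bc := by
      rw [← mul_assoc, ← Real.exp_add, neg_add_cancel, Real.exp_zero, one_mul]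
    rw [← h2]
    exact mul_le_mul_of_nonneg_left h1 (Real.exp_pos _).le
  have hsum' : 0 ≤ ∑ τ : Λ → ℤˣ, isingWeight G Λ β h bc' τ * A.indicator 1 (glue Λ τ .free) :=
    sum_nonneg fun τ _ => mul_nonneg (isingWeight_pos G Λ β h bc' τ).le (hind τ)
  calc (∑ τ : Λ → ℤˣ, isingWeight G Λ β h bc τ * A.indicator 1 (glue Λ τ .free)) / isingPartitionFunction G Λ β h bc
      ≤ (Real.exp (2 * B) * ∑ τ : Λ → ℤˣ, isingWeight G Λ β h bc' τ * A.indicator 1 (glue Λ τ .free)) /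
          (Real.exp (-(2 * B)) * isingPartitionFunction G Λ β h bc') :=
        div_le_div₀ (mul_nonneg (Real.exp_pos _).le hsum') hnum (mul_pos (Real.exp_pos _) hZ') hden
    _ = Real.exp (4 * B) * ((∑ τ : Λ → ℤˣ, isingWeight G Λ β h bc' τ * A.indicator 1 (glue Λ τ .free)) /
          isingPartitionFunction G Λ β h bc') := by
        rw [show (4 : ℝ) * B = 2 * B + 2 * B by ring, Real.exp_add, Real.exp_neg]
        field_simp

/-- `∫ M_Λ dμ^{bc}_{Λ;β,h} = Σ_{x∈Λ} ⟨σ_x⟩^{bc}_{Λ;β,h}`. [cite: FriedliVelenik2017, §3.2.3 eq. (3.7)] -/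
theorem integral_sum_spinAt_eq_sum_isingCorr (Λ : Finset V) (β h : ℝ) (bc : BoundaryCondition V) :
    ∫ σ, (∑ x ∈ Λ, spinAt x σ) ∂isingMeasure G Λ β h bc = ∑ x ∈ Λ, isingCorr G Λ β h bc {x} := by
  rw [integral_finsetSum _ fun x _ => ?_]
  · exact sum_congr rfl fun x _ => by simp only [isingCorr, isingExpect, spinProduct_singleton]
  · exact (integrable_const (1 : ℝ)).mono' (measurable_spinAt x).aestronglyMeasurable
      (ae_of_all _ fun σ => by rw [Real.norm_eq_abs]; exact (abs_spinAt x σ).le)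

end FiniteVolume

/-! ### `ℤ^d`, zero field: under `±` boundary conditions the density stays `≥ m* − ε` / `≤ −m* + ε` with probability `≥ ε/(1 − m* + ε)` -/

variable {d : ℕ}

/-- **`|Λ_N| m*(β) ≤ ⟨M_N⟩^+_{Λ_N;β,0}`** (`β ≥ 0`): every finite-volume `+` magnetisation dominates `m*`
(`⟨σ_x⟩⁺_{β,0} = m*` by translation invariance and `⟨σ_x⟩⁺ ≤ ⟨σ_x⟩^+_{Λ}` by FKG volume monotonicity).
[cite: FriedliVelenik2017, Lemma 3.31 (1) and eq. (3.41); Ellis2006, Thm. V.6.1 (a)] -/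
theorem card_mul_spontaneousMagnetization_le_integral_sum_spinAt_plus {β : ℝ} (hβ : 0 ≤ β) (N : ℕ) :
    #(box d N) * spontaneousMagnetization d β ≤
      ∫ σ, (∑ x ∈ box d N, spinAt x σ) ∂isingMeasure (zdGraph d) (box d N) β 0 .plus := by
  rw [integral_sum_spinAt_eq_sum_isingCorr]
  have hm : ∀ x ∈ box d N, spontaneousMagnetization d β ≤ isingCorr (zdGraph d) (box d N) β 0 .plus {x} := by
    intro x _
    have h1 := IsingSusceptibility.plusCorr_singleton_le_isingCorr_plus_box (d := d) hβ 0 x N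
    rw [IsingSusceptibility.plusCorr_singleton_eq_zero_site hβ 0 x] at h1
    have h0 : plusCorr d β 0 {0} = spontaneousMagnetization d β := by
      simp only [plusCorr, spontaneousMagnetization, spinProduct_singleton]
    rwa [h0] at h1
  calc (#(box d N) : ℝ) * spontaneousMagnetization d β = ∑ x ∈ box d N, spontaneousMagnetization d β := by
        rw [sum_const, nsmul_eq_mul]
    _ ≤ _ := sum_le_sum hm

/-- **Markov for a bounded observable**: if `|X| ≤ V` pointwise (`V > 0`), `m ≤ 1`, `ε > 0` and `V m ≤ ∫ X dμ` for a
probability measure `μ`, then `ε/(1 − m + ε) ≤ μ{(m − ε)V ≤ X}` (Markov's inequality for `V − X ≥ 0`). [folklore] -/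
theorem div_le_measureReal_ge_of_integral_ge {Ω : Type*} [MeasurableSpace Ω] (μ : Measure Ω) [IsProbabilityMeasure μ]
    {X : Ω → ℝ} (hX : Measurable X) {Vn : ℝ} (hV : 0 < Vn) (hbound : ∀ ω, |X ω| ≤ Vn) {m ε : ℝ} (hm : m ≤ 1)
    (hε : 0 < ε) (hint : Vn * m ≤ ∫ ω, X ω ∂μ) :
    ε / (1 - m + ε) ≤ μ.real {ω | (m - ε) * Vn ≤ X ω} := by
  have hden : 0 < 1 - m + ε := by linarith
  have hX_int : Integrable X μ := (integrable_const Vn).mono' hX.aestronglyMeasurable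
    (ae_of_all _ fun ω => by rw [Real.norm_eq_abs]; exact hbound ω)
  -- Markov for `Y = V − X ≥ 0`, `∫ Y ≤ V (1 − m)`
  set Y : Ω → ℝ := fun ω => Vn - X ω with hY
  have hY_nonneg : ∀ ω, 0 ≤ Y ω := fun ω => by
    simp only [hY]; linarith [le_abs_self (X ω), hbound ω]
  have hY_int : Integrable Y μ := (integrable_const Vn).sub hX_int
  have hEY : ∫ ω, Y ω ∂μ ≤ Vn * (1 - m) := by
    simp only [hY]
    rw [integral_sub (integrable_const Vn) hX_int, integral_const, smul_eq_mul, probReal_univ, one_mul]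
    linarith
  have hmarkov : Vn * (1 - m + ε) * μ.real {ω | Vn * (1 - m + ε) ≤ Y ω} ≤ ∫ ω, Y ω ∂μ :=
    mul_meas_ge_le_integral_of_nonneg (ae_of_all _ hY_nonneg) hY_int _
  have hsub : {ω | (m - ε) * Vn ≤ X ω}ᶜ ⊆ {ω | Vn * (1 - m + ε) ≤ Y ω} := by
    intro ω hω
    simp only [mem_compl_iff, mem_setOf_eq, not_le, hY] at hω ⊢
    nlinarith
  have hmeas : MeasurableSet {ω | (m - ε) * Vn ≤ X ω} := measurableSet_le measurable_const hX
  have hcompl : μ.real {ω | (m - ε) * Vn ≤ X ω}ᶜ ≤ (1 - m) / (1 - m + ε) := by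
    refine (measureReal_mono hsub).trans ?_
    rw [le_div_iff₀ hden]
    have h2 : Vn * ((1 - m + ε) * μ.real {ω | Vn * (1 - m + ε) ≤ Y ω}) ≤ Vn * (1 - m) := by
      rw [← mul_assoc]; exact hmarkov.trans hEY
    have h3 := le_of_mul_le_mul_left h2 hV
    linarith [h3]
  rw [measureReal_compl hmeas, probReal_univ] at hcompl
  have : ε / (1 - m + ε) = 1 - (1 - m) / (1 - m + ε) := by
    field_simp
    ring
  rw [this]
  linarith

/-- **MARKOV UNDER THE `+` BOUNDARY CONDITION: `ε/(1 − m*(β) + ε) ≤ μ^{+}_{Λ_N;β,0}{(m*(β) − ε)|Λ_N| ≤ M_N}`** for every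
`N`, `β ≥ 0`, `ε > 0` (Markov for `|Λ_N| − M_N ≥ 0`, whose mean is `≤ |Λ_N|(1 − m*)`).
[cite: Ellis2006, Thm. V.6.1 (d) (proof); FriedliVelenik2017, Lemma 3.31] -/
theorem div_le_measureReal_plus_ge {β : ℝ} (hβ : 0 ≤ β) {ε : ℝ} (hε : 0 < ε) (N : ℕ) :
    ε / (1 - spontaneousMagnetization d β + ε) ≤
      (isingMeasure (zdGraph d) (box d N) β 0 .plus).real
        {σ | (spontaneousMagnetization d β - ε) * #(box d N) ≤ ∑ x ∈ box d N, spinAt x σ} :=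
  div_le_measureReal_ge_of_integral_ge _ (measurable_sum_spinAt (box d N))
    (by exact_mod_cast (box_nonempty d N).card_pos) (fun σ => abs_sum_spinAt_le σ (box d N))
    (spontaneousMagnetization_le_one_holds (d := d) hβ) hε
    (card_mul_spontaneousMagnetization_le_integral_sum_spinAt_plus (d := d) hβ N)

/-- **MARKOV UNDER THE `−` BOUNDARY CONDITION: `ε/(1 − m*(β) + ε) ≤ μ^{−}_{Λ_N;β,0}{M_N ≤ (−m*(β) + ε)|Λ_N|}`**
(`⟨σ_x⟩^−_{Λ;β,0} ≤ ⟨σ_x⟩⁻_{β,0} = −m*(β)`, then Markov for `|Λ_N| + M_N ≥ 0`).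
[cite: Ellis2006, Thm. V.6.1 (d) (proof); FriedliVelenik2017, Lemma 3.31 and §3.7.1] -/
theorem div_le_measureReal_minus_le {β : ℝ} (hβ : 0 ≤ β) {ε : ℝ} (hε : 0 < ε) (N : ℕ) :
    ε / (1 - spontaneousMagnetization d β + ε) ≤
      (isingMeasure (zdGraph d) (box d N) β 0 .minus).real
        {σ | ∑ x ∈ box d N, spinAt x σ ≤ (-spontaneousMagnetization d β + ε) * #(box d N)} := by
  set μ := isingMeasure (zdGraph d) (box d N) β 0 .minus with hμ
  set m := spontaneousMagnetization d β with hm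
  -- `⟨M_N⟩^− ≤ −|Λ_N| m*`
  have hEM : ∫ σ, (∑ x ∈ box d N, spinAt x σ) ∂μ ≤ -(#(box d N) * m) := by
    rw [hμ, integral_sum_spinAt_eq_sum_isingCorr]
    have hx : ∀ x ∈ box d N, isingCorr (zdGraph d) (box d N) β 0 .minus {x} ≤ -m := by
      intro x _
      have h1 := IsingSusceptibility.isingCorr_minus_box_singleton_le_minusCorr (d := d) hβ 0 x N
      rw [minusCorr_eq_plusCorr_neg hβ 0 {x}, neg_zero, Finset.card_singleton, pow_one, neg_one_mul,
        IsingSusceptibility.plusCorr_singleton_eq_zero_site hβ 0 x] at h1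
      have h0 : plusCorr d β 0 {0} = m := by
        simp only [hm, plusCorr, spontaneousMagnetization, spinProduct_singleton]
      rwa [h0] at h1
    calc ∑ x ∈ box d N, isingCorr (zdGraph d) (box d N) β 0 .minus {x} ≤ ∑ x ∈ box d N, (-m) := sum_le_sum hx
      _ = -(#(box d N) * m) := by rw [sum_const, nsmul_eq_mul]; ring
  have hint : (#(box d N) : ℝ) * m ≤ ∫ σ, -(∑ x ∈ box d N, spinAt x σ) ∂μ := by
    rw [integral_neg]; linarith
  have h := div_le_measureReal_ge_of_integral_ge μ (X := fun σ => -(∑ x ∈ box d N, spinAt x σ))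
    (measurable_sum_spinAt (box d N)).neg (by exact_mod_cast (box_nonempty d N).card_pos)
    (fun σ => by rw [abs_neg]; exact abs_sum_spinAt_le σ (box d N))
    (spontaneousMagnetization_le_one_holds (d := d) hβ) hε hint
  have hset : {σ : SpinConfig (Site d) | (m - ε) * #(box d N) ≤ -(∑ x ∈ box d N, spinAt x σ)} =
      {σ | ∑ x ∈ box d N, spinAt x σ ≤ (-m + ε) * #(box d N)} := by
    ext σ; simp only [mem_setOf_eq]; constructor <;> intro h1 <;> linarith
  rwa [hset] at h

/-! ### Every boundary condition: both phases at surface-order cost -/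

/-- **PHASE COEXISTENCE UNDER EVERY BOUNDARY CONDITION, `+` SIDE: `e^{−4|β||∂ᵉΛ_N|} ε/(1 − m* + ε) ≤
μ^{bc}_{Λ_N;β,0}{M_N ≥ (m*(β) − ε)|Λ_N|}`** for every `N`, every boundary condition, `β ≥ 0`, `ε > 0`: reaching the
`+` phase density costs at most a SURFACE-order factor. [cite: Ellis2006, Thm. V.6.1 (d)–(e) and Note 13 to Ch. IV; FriedliVelenik2017, Thm. 3.6 (proof)] -/
theorem exp_mul_div_le_measureReal_ge {β : ℝ} (hβ : 0 ≤ β) {ε : ℝ} (hε : 0 < ε) (bc : BoundaryCondition (Site d))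
    (N : ℕ) :
    Real.exp (-(4 * (|β| * #(edgeBoundary (zdGraph d) (box d N))))) * (ε / (1 - spontaneousMagnetization d β + ε)) ≤
      (isingMeasure (zdGraph d) (box d N) β 0 bc).real
        {σ | (spontaneousMagnetization d β - ε) * #(box d N) ≤ ∑ x ∈ box d N, spinAt x σ} := by
  have hS : MeasurableSet (Ici ((spontaneousMagnetization d β - ε) * #(box d N))) := measurableSet_Ici
  have h1 := measureReal_sum_spinAt_mem_le_exp_mul (zdGraph d) (box d N) β 0 .plus bc hS
  simp only [Set.mem_Ici] at h1
  have h2 := div_le_measureReal_plus_ge (d := d) hβ hε N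
  set B := 4 * (|β| * (#(edgeBoundary (zdGraph d) (box d N)) : ℝ))
  calc Real.exp (-B) * (ε / (1 - spontaneousMagnetization d β + ε))
      ≤ Real.exp (-B) * (Real.exp B * (isingMeasure (zdGraph d) (box d N) β 0 bc).real
          {σ | (spontaneousMagnetization d β - ε) * #(box d N) ≤ ∑ x ∈ box d N, spinAt x σ}) :=
        mul_le_mul_of_nonneg_left (h2.trans h1) (Real.exp_pos _).le
    _ = _ := by rw [← mul_assoc, ← Real.exp_add, neg_add_cancel, Real.exp_zero, one_mul]

/-- **PHASE COEXISTENCE UNDER EVERY BOUNDARY CONDITION, `−` SIDE: `e^{−4|β||∂ᵉΛ_N|} ε/(1 − m* + ε) ≤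
μ^{bc}_{Λ_N;β,0}{M_N ≤ (−m*(β) + ε)|Λ_N|}`**. [cite: Ellis2006, Thm. V.6.1 (d)–(e) and Note 13 to Ch. IV; FriedliVelenik2017, Thm. 3.6 (proof)] -/
theorem exp_mul_div_le_measureReal_le {β : ℝ} (hβ : 0 ≤ β) {ε : ℝ} (hε : 0 < ε) (bc : BoundaryCondition (Site d))
    (N : ℕ) :
    Real.exp (-(4 * (|β| * #(edgeBoundary (zdGraph d) (box d N))))) * (ε / (1 - spontaneousMagnetization d β + ε)) ≤
      (isingMeasure (zdGraph d) (box d N) β 0 bc).real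
        {σ | ∑ x ∈ box d N, spinAt x σ ≤ (-spontaneousMagnetization d β + ε) * #(box d N)} := by
  have hS : MeasurableSet (Iic ((-spontaneousMagnetization d β + ε) * #(box d N))) := measurableSet_Iic
  have h1 := measureReal_sum_spinAt_mem_le_exp_mul (zdGraph d) (box d N) β 0 .minus bc hS
  simp only [Set.mem_Iic] at h1
  have h2 := div_le_measureReal_minus_le (d := d) hβ hε N
  set B := 4 * (|β| * (#(edgeBoundary (zdGraph d) (box d N)) : ℝ))
  calc Real.exp (-B) * (ε / (1 - spontaneousMagnetization d β + ε))
      ≤ Real.exp (-B) * (Real.exp B * (isingMeasure (zdGraph d) (box d N) β 0 bc).real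
          {σ | ∑ x ∈ box d N, spinAt x σ ≤ (-spontaneousMagnetization d β + ε) * #(box d N)}) :=
        mul_le_mul_of_nonneg_left (h2.trans h1) (Real.exp_pos _).le
    _ = _ := by rw [← mul_assoc, ← Real.exp_add, neg_add_cancel, Real.exp_zero, one_mul]

/-- A surface-order lower bound defeats every volume-order exponential upper bound: if `0 < κ` then for every
`c > 0`, eventually `e^{−c|Λ_N|} < e^{−4|β||∂ᵉΛ_N|} κ` (`|∂ᵉΛ_N|/|Λ_N| → 0`, `|Λ_N| → ∞`).
[cite: FriedliVelenik2017, §3.2.1 Exercise 3.1 (van Hove boxes)] -/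
theorem eventually_exp_neg_mul_card_lt (hd : 1 ≤ d) (β : ℝ) {κ : ℝ} (hκ : 0 < κ) {c : ℝ} (hc : 0 < c) :
    ∀ᶠ N : ℕ in atTop, Real.exp (-(c * #(box d N))) <
      Real.exp (-(4 * (|β| * #(edgeBoundary (zdGraph d) (box d N))))) * κ := by
  have hcard : Tendsto (fun N : ℕ => (#(box d N) : ℝ)) atTop atTop := by
    refine tendsto_atTop_mono (fun N => ?_) tendsto_natCast_atTop_atTop
    have h1 : N ≤ #(box d N) := by
      rw [card_box]
      exact (show N ≤ 2 * N + 1 by omega).trans (Nat.le_self_pow (by omega) _)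
    exact_mod_cast h1
  have hratio := tendsto_card_edgeBoundary_box_div d
  -- eventually `4|β| |∂Λ| ≤ (c/2) |Λ|` and `e^{−(c/2)|Λ|} < κ`
  have hev1 : ∀ᶠ N : ℕ in atTop, 4 * (|β| * (#(edgeBoundary (zdGraph d) (box d N)) : ℝ)) ≤ c / 2 * #(box d N) := by
    have h1 : ∀ᶠ N : ℕ in atTop, (#(edgeBoundary (zdGraph d) (box d N)) : ℝ) / #(box d N) < c / (8 * (|β| + 1)) :=
      hratio.eventually (gt_mem_nhds (by positivity))
    filter_upwards [h1] with N hN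
    have hV : (0 : ℝ) < #(box d N) := by exact_mod_cast (box_nonempty d N).card_pos
    rw [div_lt_iff₀ hV] at hN
    have hb : (0 : ℝ) ≤ #(edgeBoundary (zdGraph d) (box d N)) := Nat.cast_nonneg _
    have hβ1 : 0 < |β| + 1 := by positivity
    have h2 : |β| * (#(edgeBoundary (zdGraph d) (box d N)) : ℝ) ≤ (|β| + 1) * #(edgeBoundary (zdGraph d) (box d N)) :=
      mul_le_mul_of_nonneg_right (by linarith) hb
    have h3 : (|β| + 1) * (#(edgeBoundary (zdGraph d) (box d N)) : ℝ) < (|β| + 1) * (c / (8 * (|β| + 1)) * #(box d N)) :=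
      mul_lt_mul_of_pos_left hN hβ1
    have h4 : (|β| + 1) * (c / (8 * (|β| + 1)) * (#(box d N) : ℝ)) = c / 8 * #(box d N) := by
      field_simp
    linarith
  have hev2 : ∀ᶠ N : ℕ in atTop, Real.exp (-(c / 2 * #(box d N))) < κ := by
    have h1 : Tendsto (fun N : ℕ => Real.exp (-(c / 2 * (#(box d N) : ℝ)))) atTop (𝓝 0) :=
      Real.tendsto_exp_atBot.comp (tendsto_neg_atTop_atBot.comp (hcard.const_mul_atTop (by positivity)))
    exact h1.eventually (gt_mem_nhds hκ) |>.mono fun N hN => hN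
  filter_upwards [hev1, hev2] with N h1 h2
  calc Real.exp (-(c * #(box d N)))
      = Real.exp (-(c / 2 * #(box d N))) * Real.exp (-(c / 2 * #(box d N))) := by
        rw [← Real.exp_add]; congr 1; ring
    _ < Real.exp (-(4 * (|β| * #(edgeBoundary (zdGraph d) (box d N))))) * κ := by
        refine mul_lt_mul' (Real.exp_le_exp.2 (by linarith)) h2 (Real.exp_pos _).le (Real.exp_pos _)

end IsingLargeDeviations

end Summit.CriticalPhenomena.PercolationContinuityZ3.Theorems.FK
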